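import Summits.HubbardSuperconductivity.HubbardSuperconductivity.Theorems.AnisotropyChordTransferFibre3B1EvalSound
import Summits.HubbardSuperconductivity.HubbardSuperconductivity.Theorems.AnisotropyChordTransferFibre3N1RowBrackets

/-!
# Route `AnisotropyChord` / H0 rotor rung, LEVEL 2 family B1: the exact-integer cell evaluator for the COS-WEIGHTED
convolutions `Tx(1,0)`, `Tx(1,1)` (PartN41-B §3 `TxBracket`)

`…Fibre3B1Eval`/`…B1EvalSound` evaluate the plain named sums; the two cos-weighted inputs of the `N₁` row
(`TxSum L λ q`, `q ∈ {(1,0), (1,1)}`, bracketed by `txBracket_holds`/`txBracket_of` at `θ₀ = 2π/128`, `K = 32`) need the lower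
window sum `loSumTx` with the irrational weight `cos(θ₀|p₁ − q₁/2|)`.  On the window that weight is `≥ 0` (`|p₁ − ½| ≤ 31.5`,
`θ₀·31.5 < π/2`) and `≥ 1 − θ₀²(p₁ − q₁/2)²/2` (`Real.one_sub_sq_div_two_le_cos`), so with a rational `T = Tn/Td ≥ θ₀²` the integer
`txWeightNum = max(8Td − Tn(2p₁ − q₁)², 0)` over `8Td` is a valid nonnegative lower weight:
* `loTxTermZ`, `loSumTxZ` (floor-rounded, `≤ D·loSumTx`), `txCellCheck n₁ n₂ νd Tn Td q D clo chi : Bool`;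
* `loSumTxZ_le`, ★ `tx_cell_sound`: `txCellCheck … = true` ⟹ for every `L ≥ 128` and `ν ∈ [n₁/νd, n₂/νd]`,
  `clo ≤ θ⁴·TxSum L (νθ²) q ≤ chi` (upper side via `hiSum_le_hiSumZ`, `hiSum_mono`, `tailConst_le_tailConstQ`).
Prover seat `hubbard-h0-rotor-p2` g4; helper for piece A = stmt-HubbardSuperconductivity-23918 of rung 19089
(`--supports`, helper class).  Nothing here proves superconductivity in the Hubbard model; helper definitions/lemmas of ONE
conditional reduction (the GM₃ ∀L certificate, Level-2 row `N₁`); the rotor TARGET as originally worded stays FALSE (g15 verdict).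
Mathlib + the tree only; no sorry.
-/

set_option linter.dupNamespace false
set_option autoImplicit false

open scoped BigOperators

namespace Summit.HubbardSuperconductivity.HubbardSuperconductivity.Theorems.AnisotropyChord.Transfer.Fibre3.B1

/-! ## Computable layer -/

/-- the clipped lower weight numerator `max(8·Td − Tn·(2p₁ − q₁)², 0)` (over `8·Td`). -/
def txWeightNum (Tn Td : ℤ) (q p : ℤ × ℤ) : ℤ := max (8 * Td - Tn * (2 * p.1 - q.1) ^ 2) 0

/-- one term of `D·loSumTx`, rounded down. -/
def loTxTermZ (νn νd Tn Td : ℤ) (K : ℕ) (q : ℤ × ℤ) (D : ℕ) (p : ℤ × ℤ) : ℤ :=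
  if allWin K ![((0 : ℤ × ℤ)), -q] p then
    ((D : ℤ) * νd ^ 2 * txWeightNum Tn Td q p) / (loDen νn νd p * loDen νn νd (p + -q) * (8 * Td))
  else 0

/-- `loSumTxZ ≤ D · loSumTx (νn/νd) θ₀ K q` for `θ₀²·Td ≤ Tn` (`loSumTxZ_le`). -/
def loSumTxZ (νn νd Tn Td : ℤ) (K : ℕ) (q : ℤ × ℤ) (D : ℕ) : ℤ :=
  gridSum (K + 1) (loTxTermZ νn νd Tn Td K q D)

/-- ★ THE CELL CERTIFICATE for `θ⁴·Tx(q)` on the `ν`-cell `[n₁/νd, n₂/νd]` (`θ₀ = 2π/128`, `K = 32`, `K′ = 30`, `q ∈ {(1,0),(1,1)}`). -/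
def txCellCheck (n1 n2 νd Tn Td : ℤ) (q : ℤ × ℤ) (D : ℕ) (clo chi : ℚ) : Bool :=
  decide (0 < νd) && decide (0 < Td) && decide (0 ≤ n1) && decide (n1 ≤ n2) &&
  decide ((n2 : ℚ) / νd * piHi ^ 2 < 4) &&
  decide ((2 * piHi / 128) ^ 2 * Td ≤ Tn) && decide (0 < D) &&
  (decide (q = (1, 0)) || decide (q = (1, 1))) &&
  hiDenPos n2 νd Tn Td 32 &&
  decide ((clo + tailConstQ n2 νd 30 2) * D ≤ (loSumTxZ n1 νd Tn Td 32 q D : ℚ)) &&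
  decide (((hiSumZ n2 νd Tn Td 32 1 ![((0 : ℤ × ℤ)), -q] ![1, 1] 2 D : ℤ) : ℚ) ≤ (chi - tailConstQ n2 νd 30 2) * D)

/-! ## Soundness -/

noncomputable section

/-- termwise: on the index set, `loTxTermZ ≤ D·(|p|²−ν)⁻¹(|p−q|²−ν)⁻¹cos(θ₀|p₁ − q₁/2|)` for `n₁/νd ≤ ν < 1`, `θ₀²Td ≤ Tn`,
`θ₀(K − ½) ≤ π/2`, `q₁ = 1`; `0 ≤ 0` off it. [folklore] -/
theorem loTxTermZ_le (νn νd Tn Td : ℤ) (hνd : 0 < νd) (hTd : 0 < Td) (θ0 : ℝ) (hθ0pos : 0 < θ0)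
    (hT : θ0 ^ 2 * Td ≤ Tn) (K : ℕ) (hθ0K : θ0 * ((K : ℝ) - 1 / 2) ≤ Real.pi / 2)
    (q : ℤ × ℤ) (hq : q.1 = 1) (D : ℕ) (ν : ℝ) (hν1 : (νn : ℝ) / νd ≤ ν) (hν : ν < 1) (p : ℤ × ℤ) :
    ((loTxTermZ νn νd Tn Td K q D p : ℤ) : ℝ)
      ≤ if allWin K ![((0 : ℤ × ℤ)), -q] p = true then
          (D : ℝ) * ((1 / (nsq p - ν)) * (1 / (nsq (p + -q) - ν))
            * Real.cos (θ0 * |(p.1 : ℝ) - (q.1 : ℝ) / 2|))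
        else 0 := by
  unfold loTxTermZ
  split_ifs with h
  · have hall := (allWin_iff K _ p).1 h
    have hp0 : p ∈ zWindow K := by simpa using hall 0
    have hp1 : p + -q ∈ zWindow K := by simpa using hall 1
    have hνdR : (0 : ℝ) < νd := by exact_mod_cast hνd
    have hTdR : (0 : ℝ) < Td := by exact_mod_cast hTd
    -- the window bound `|p₁ − ½| ≤ K − ½`
    obtain ⟨hpz, ⟨h1a, h1b⟩, -⟩ := (mem_zWindow_iff K p).1 hp0
    obtain ⟨hpz', ⟨h2a, h2b⟩, -⟩ := (mem_zWindow_iff K (p + -q)).1 hp1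
    simp only [Prod.fst_add, Prod.fst_neg, hq] at h2a h2b
    have hq1R : (q.1 : ℝ) = 1 := by exact_mod_cast hq
    have hj : |(p.1 : ℝ) - (q.1 : ℝ) / 2| ≤ (K : ℝ) - 1 / 2 := by
      rw [hq1R, abs_le]
      constructor
      · have : (-(K : ℤ) + 1 : ℝ) ≤ (p.1 : ℝ) := by exact_mod_cast (show -(K : ℤ) + 1 ≤ p.1 by omega)
        push_cast at this
        linarith
      · have : (p.1 : ℝ) ≤ (K : ℝ) := by exact_mod_cast h1b
        linarith
    -- the weight: `cos(θ₀|j|) ≥ max(1 − T j²/2, 0) = txWeightNum/(8Td)`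
    set j : ℝ := |(p.1 : ℝ) - (q.1 : ℝ) / 2| with hjdef
    have hcos0 : 0 ≤ Real.cos (θ0 * j) := by
      apply Real.cos_nonneg_of_neg_pi_div_two_le_of_le
      · have : 0 ≤ θ0 * j := by positivity
        linarith [Real.pi_pos]
      · calc θ0 * j ≤ θ0 * ((K : ℝ) - 1 / 2) := mul_le_mul_of_nonneg_left hj hθ0pos.le
          _ ≤ Real.pi / 2 := hθ0K
    have hcosT : 1 - (Tn : ℝ) / Td * (2 * (p.1 : ℝ) - (q.1 : ℝ)) ^ 2 / 8 ≤ Real.cos (θ0 * j) := by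
      have h1 := Real.one_sub_sq_div_two_le_cos (x := θ0 * j)
      have hj2 : j ^ 2 = (2 * (p.1 : ℝ) - (q.1 : ℝ)) ^ 2 / 4 := by
        rw [hjdef, sq_abs]; ring
      have hθT : θ0 ^ 2 ≤ (Tn : ℝ) / Td := by rw [le_div_iff₀ hTdR]; exact hT
      have : θ0 ^ 2 * j ^ 2 ≤ (Tn : ℝ) / Td * j ^ 2 := mul_le_mul_of_nonneg_right hθT (sq_nonneg _)
      have e : (θ0 * j) ^ 2 = θ0 ^ 2 * j ^ 2 := by ring
      rw [e] at h1
      rw [hj2] at this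
      nlinarith
    have hw : ((txWeightNum Tn Td q p : ℤ) : ℝ) / (8 * Td) ≤ Real.cos (θ0 * j) := by
      unfold txWeightNum
      push_cast
      rw [div_le_iff₀ (by positivity)]
      apply max_le
      · have := mul_le_mul_of_nonneg_right hcosT (by positivity : (0 : ℝ) ≤ 8 * Td)
        have e : (1 - (Tn : ℝ) / Td * (2 * (p.1 : ℝ) - (q.1 : ℝ)) ^ 2 / 8) * (8 * Td)
            = 8 * Td - Tn * (2 * (p.1 : ℝ) - (q.1 : ℝ)) ^ 2 := by field_simp
        linarith
      · positivity
    have hw0 : (0 : ℝ) ≤ ((txWeightNum Tn Td q p : ℤ) : ℝ) := by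
      unfold txWeightNum; exact_mod_cast le_max_right _ _
    -- the factors at `ν ≥ n₁/νd`
    have hνlt : (νn : ℝ) / νd < 1 := lt_of_le_of_lt hν1 hν
    have hνn : νn < νd := by
      by_contra hc
      push Not at hc
      have : (1 : ℝ) ≤ (νn : ℝ) / νd := by
        rw [le_div_iff₀ hνdR, one_mul]; exact_mod_cast hc
      linarith
    have hf1 := lo_factor_eq νn νd hνd hνn p hpz
    have hf2 := lo_factor_eq νn νd hνd hνn (p + -q) hpz'
    have hn1 : (1 : ℝ) ≤ nsq p := by unfold nsq; exact one_le_sq_add_sq _ _ hpz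
    have hn2 : (1 : ℝ) ≤ nsq (p + -q) := by unfold nsq; exact one_le_sq_add_sq _ _ hpz'
    have hg1 : (νd : ℝ) / (loDen νn νd p : ℝ) ≤ 1 / (nsq p - ν) := by
      rw [← hf1.2]; exact one_div_le_one_div_of_le (by linarith) (by linarith)
    have hg2 : (νd : ℝ) / (loDen νn νd (p + -q) : ℝ) ≤ 1 / (nsq (p + -q) - ν) := by
      rw [← hf2.2]; exact one_div_le_one_div_of_le (by linarith) (by linarith)
    have hL1 : (0 : ℝ) < (loDen νn νd p : ℝ) := by exact_mod_cast hf1.1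
    have hL2 : (0 : ℝ) < (loDen νn νd (p + -q) : ℝ) := by exact_mod_cast hf2.1
    have hg1_0 : (0 : ℝ) ≤ (νd : ℝ) / (loDen νn νd p : ℝ) := by positivity
    have hg2_0 : (0 : ℝ) ≤ (νd : ℝ) / (loDen νn νd (p + -q) : ℝ) := by positivity
    -- real lower bound of the term
    have hterm : ((νd : ℝ) / (loDen νn νd p : ℝ)) * ((νd : ℝ) / (loDen νn νd (p + -q) : ℝ))
          * (((txWeightNum Tn Td q p : ℤ) : ℝ) / (8 * Td))
        ≤ (1 / (nsq p - ν)) * (1 / (nsq (p + -q) - ν)) * Real.cos (θ0 * j) := by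
      apply mul_le_mul (mul_le_mul hg1 hg2 hg2_0 (hg1_0.trans hg1)) hw (by positivity)
      exact mul_nonneg (hg1_0.trans hg1) (hg2_0.trans hg2)
    -- the integer quotient
    set M : ℤ := loDen νn νd p * loDen νn νd (p + -q) * (8 * Td) with hM
    have hMpos : 0 < M := by rw [hM]; exact mul_pos (mul_pos hf1.1 hf2.1) (by linarith)
    have hMR : (0 : ℝ) < (M : ℝ) := by exact_mod_cast hMpos
    have hdiv := Int.ediv_mul_le ((D : ℤ) * νd ^ 2 * txWeightNum Tn Td q p) hMpos.ne'
    have hquot : ((((D : ℤ) * νd ^ 2 * txWeightNum Tn Td q p) / M : ℤ) : ℝ)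
        ≤ (((D : ℤ) * νd ^ 2 * txWeightNum Tn Td q p : ℤ) : ℝ) / (M : ℝ) := by
      rw [le_div_iff₀ hMR]; exact_mod_cast hdiv
    have hval : (((D : ℤ) * νd ^ 2 * txWeightNum Tn Td q p : ℤ) : ℝ) / (M : ℝ)
        = (D : ℝ) * (((νd : ℝ) / (loDen νn νd p : ℝ)) * ((νd : ℝ) / (loDen νn νd (p + -q) : ℝ))
          * (((txWeightNum Tn Td q p : ℤ) : ℝ) / (8 * Td))) := by
      rw [hM]
      push_cast
      field_simp
    calc ((((D : ℤ) * νd ^ 2 * txWeightNum Tn Td q p) / M : ℤ) : ℝ)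
        ≤ _ := hquot
      _ = _ := hval
      _ ≤ (D : ℝ) * ((1 / (nsq p - ν)) * (1 / (nsq (p + -q) - ν)) * Real.cos (θ0 * j)) :=
          mul_le_mul_of_nonneg_left hterm (by positivity)
  · simp

/-- ★ LOWER evaluation for `Tx`: `loSumTxZ ≤ D · loSumTx ν θ₀ K q` for `n₁/νd ≤ ν < 1` (same hypotheses). -/
theorem loSumTxZ_le (νn νd Tn Td : ℤ) (hνd : 0 < νd) (hTd : 0 < Td) (θ0 : ℝ) (hθ0pos : 0 < θ0)
    (hT : θ0 ^ 2 * Td ≤ Tn) (K : ℕ) (hθ0K : θ0 * ((K : ℝ) - 1 / 2) ≤ Real.pi / 2)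
    (q : ℤ × ℤ) (hq : q.1 = 1) (D : ℕ) (ν : ℝ) (hν1 : (νn : ℝ) / νd ≤ ν) (hν : ν < 1) :
    ((loSumTxZ νn νd Tn Td K q D : ℤ) : ℝ) ≤ (D : ℝ) * loSumTx ν θ0 K q := by
  unfold loSumTxZ loSumTx
  rw [cast_gridSum, sum_idx_eq_grid, Finset.mul_sum]
  refine Finset.sum_le_sum fun i _ => ?_
  rw [Finset.mul_sum]
  refine Finset.sum_le_sum fun j _ => ?_
  rw [mul_ite, mul_zero]
  have h := loTxTermZ_le νn νd Tn Td hνd hTd θ0 hθ0pos hT K hθ0K q hq D ν hν1 hν (boxPt (K + 1) i j)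
  simp only [← sub_eq_add_neg] at h ⊢
  exact h

/-- ★★ **SOUNDNESS OF THE `Tx` CELL CERTIFICATE**: `txCellCheck n₁ n₂ νd Tn Td q D clo chi = true` ⟹ for every `L ≥ 128` and
every `ν ∈ [n₁/νd, n₂/νd]`: `clo ≤ (2π/L)⁴ · TxSum L (ν(2π/L)²) q ≤ chi`. -/
theorem tx_cell_sound (n1 n2 νd Tn Td : ℤ) (q : ℤ × ℤ) (D : ℕ) (clo chi : ℚ)
    (h : txCellCheck n1 n2 νd Tn Td q D clo chi = true)
    (L : ℕ) [NeZero L] (hL : 128 ≤ L) (ν : ℝ) (hν1 : (n1 : ℝ) / νd ≤ ν) (hν2 : ν ≤ (n2 : ℝ) / νd) :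
    ((clo : ℚ) : ℝ) ≤ (2 * Real.pi / L) ^ (2 * 2) * TxSum L (ν * (2 * Real.pi / L) ^ 2) q ∧
      (2 * Real.pi / L) ^ (2 * 2) * TxSum L (ν * (2 * Real.pi / L) ^ 2) q ≤ ((chi : ℚ) : ℝ) := by
  unfold txCellCheck at h
  simp only [Bool.and_eq_true, Bool.or_eq_true, decide_eq_true_eq] at h
  obtain ⟨⟨⟨⟨⟨⟨⟨⟨⟨⟨hνd, hTd⟩, hn1⟩, hn12⟩, hc⟩, hT⟩, hD⟩, hq⟩, hpos⟩, hlo⟩, hhi⟩ := h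
  have hpi := Real.pi_pos
  have hP : Real.pi ≤ ((piHi : ℚ) : ℝ) := by
    have e : ((piHi : ℚ) : ℝ) = 3.1416 := by unfold piHi; norm_num
    rw [e]
    exact Real.pi_lt_d4.le
  have hq1 : q.1 = 1 ∧ q.2.natAbs ≤ 1 := by rcases hq with rfl | rfl <;> decide
  -- the cell endpoints
  have hνdR : (0 : ℝ) < νd := by exact_mod_cast hνd
  have hν1_0 : (0 : ℝ) ≤ (n1 : ℝ) / νd := div_nonneg (by exact_mod_cast hn1) hνdR.le
  have hn2R : (0 : ℝ) ≤ (n2 : ℝ) / νd := div_nonneg (by exact_mod_cast (hn1.trans hn12)) hνdR.le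
  have hcR : (n2 : ℝ) / νd * (((piHi : ℚ) : ℝ)) ^ 2 < 4 := by exact_mod_cast hc
  have hν2_lt : (n2 : ℝ) / νd < 4 / Real.pi ^ 2 := by
    rw [lt_div_iff₀ (by positivity)]
    have : Real.pi ^ 2 ≤ (((piHi : ℚ) : ℝ)) ^ 2 := pow_le_pow_left₀ hpi.le hP 2
    nlinarith
  have hν0 : 0 ≤ ν := hν1_0.trans hν1
  have hν : ν < 4 / Real.pi ^ 2 := lt_of_le_of_lt hν2 hν2_lt
  have hν_1 : ν < 1 := by
    have hpi3 := Real.pi_gt_three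
    refine lt_of_lt_of_le hν ?_
    rw [div_le_one (by positivity)]; nlinarith
  -- scales
  obtain ⟨hθ0, hθ0K, -⟩ := scales_128 L hL
  have hθ0pos : (0 : ℝ) < 2 * Real.pi / 128 := by positivity
  have hθ0K' : 2 * Real.pi / 128 * (((32 : ℕ) : ℝ) - 1 / 2) ≤ Real.pi / 2 := by push_cast; nlinarith
  -- the pointwise bracket at `ν`
  obtain ⟨hmid_lo, hmid_hi⟩ := txBracket_of L (2 * Real.pi / 128) 32 (by norm_num) hθ0 hθ0K ν hν0 hν q hq1
  -- T dominates θ₀²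
  have hTd' : (0 : ℝ) < Td := by exact_mod_cast hTd
  have hTR : (2 * Real.pi / 128) ^ 2 * (Td : ℝ) ≤ Tn := by
    have h1 : (2 * Real.pi / 128) ^ 2 ≤ (2 * (((piHi : ℚ) : ℝ)) / 128) ^ 2 := by
      apply pow_le_pow_left₀ (by positivity)
      exact div_le_div_of_nonneg_right (by linarith) (by norm_num)
    have h2' : (2 * (((piHi : ℚ) : ℝ)) / 128) ^ 2 * (Td : ℝ) ≤ Tn := by exact_mod_cast hT
    nlinarith
  have hDR : (0 : ℝ) < D := by exact_mod_cast hD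
  -- evaluations
  have elo := loSumTxZ_le n1 νd Tn Td hνd hTd (2 * Real.pi / 128) hθ0pos hTR 32 hθ0K' q hq1.1 D ν hν1 hν_1
  have ehi := hiSum_le_hiSumZ n2 νd Tn Td hνd hTd (2 * Real.pi / 128) hTR 32 1 hpos
    ![((0 : ℤ × ℤ)), -q] ![1, 1] 2 D (by simp)
  have etail := tailConst_le_tailConstQ n2 νd hνd (hn1.trans hn12) hc 30 2 (by norm_num)
  have etail_mono : tailConst ν (32 - 2 * 1) 2 ≤ tailConst ((n2 : ℝ) / νd) 30 2 := by
    rw [show (32 - 2 * 1 : ℕ) = 30 by norm_num]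
    exact tailConst_mono ν _ hν0 hν2 hν2_lt 30 2 (by norm_num)
  have ehi_mono := hiSum_mono L ν ((n2 : ℝ) / νd) hν2 hν2_lt (2 * Real.pi / 128) 32 1 hθ0 hθ0K
    ![((0 : ℤ × ℤ)), -q] ![1, 1]
  have hloR : (((clo : ℚ) : ℝ) + ((tailConstQ n2 νd 30 2 : ℚ) : ℝ)) * D
      ≤ ((loSumTxZ n1 νd Tn Td 32 q D : ℤ) : ℝ) := by exact_mod_cast hlo
  have hhiR : ((hiSumZ n2 νd Tn Td 32 1 ![((0 : ℤ × ℤ)), -q] ![1, 1] 2 D : ℤ) : ℝ)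
      ≤ (((chi : ℚ) : ℝ) - ((tailConstQ n2 νd 30 2 : ℚ) : ℝ)) * D := by exact_mod_cast hhi
  constructor
  · have h1 : ((clo : ℚ) : ℝ) + ((tailConstQ n2 νd 30 2 : ℚ) : ℝ) ≤ loSumTx ν (2 * Real.pi / 128) 32 q := by
      rw [← mul_le_mul_iff_left₀ hDR]
      calc (((clo : ℚ) : ℝ) + ((tailConstQ n2 νd 30 2 : ℚ) : ℝ)) * D ≤ _ := hloR
        _ ≤ (D : ℝ) * loSumTx ν (2 * Real.pi / 128) 32 q := elo
        _ = loSumTx ν (2 * Real.pi / 128) 32 q * D := mul_comm _ _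
    linarith
  · have h1 : hiSum ((n2 : ℝ) / νd) (2 * Real.pi / 128) 32 1 ![((0 : ℤ × ℤ)), -q] ![1, 1]
        ≤ ((chi : ℚ) : ℝ) - ((tailConstQ n2 νd 30 2 : ℚ) : ℝ) := by
      rw [← mul_le_mul_iff_left₀ hDR]
      calc hiSum ((n2 : ℝ) / νd) (2 * Real.pi / 128) 32 1 ![((0 : ℤ × ℤ)), -q] ![1, 1] * D
          = (D : ℝ) * hiSum ((n2 : ℝ) / νd) (2 * Real.pi / 128) 32 1 ![((0 : ℤ × ℤ)), -q] ![1, 1] := mul_comm _ _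
        _ ≤ _ := ehi
        _ ≤ _ := hhiR
    linarith

end

end Summit.HubbardSuperconductivity.HubbardSuperconductivity.Theorems.AnisotropyChord.Transfer.Fibre3.B1
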